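import Summits.QuantumFields.YangMills.Theorems.AllWindowsColdBoxTiltCubicIntegrable
import Mathlib.Algebra.Order.Chebyshev
import HarnessLib

/-!
# LINE-17 «hypercontractive second-order tilt expansion» on crux `AllWindowsColdBox.BoxMidWindowsSU22` (stmt-QuantumFields-24003):
# local ingredients of stub F `stub_gaussSideTerms` (STUB-PLAN-E §5), part B: Gaussian moments of one leg, of the local cubic term
# and of the quartic remainder of ONE plaquette

Continuation of `…GaussSideLocal` (parity, three colours).  With `a_e = extZero (unscaleTE H D β t) e` the chart coordinate of an
arbitrary edge `e` of `ℤ⁴` (zero on pinned edges), the local cubic term `c_x` and the quartic remainder `r_x = 560β·Σ_legs ‖a_leg‖⁴`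
of the plaquette `(x,i,j)` (E(0) `abs_qObsD_sub_beta_mul_plaqCostAt_sub_cubic_le`):

* §1 `integral_norm_leg_pow_le`: `∫ ‖a_e‖^{2k} dγ ≤ D^k·(2k−1)!!·(16H)^k/β^k` and integrability (`H ≥ 1`, `β > 0`, `k ≥ 1`);
* §3 `abs_localCubic_le`: `|c_x| ≤ 6β(Σ_legs‖a‖)³`; `integral_pow_four_le_of_cubic_leg_bound`: any `c` so dominated has
  `∫ c⁴ dγ ≤ 6⁴4¹²10395·D⁶(16H)⁶/β²` (`‖c_x‖_{L⁴(γ)} ≲ H^{3/2}/√β`); `integral_remainder_moments_le`: `∫ r_x² ≤ 560²·16·105·D⁴(16H)⁴/β²`,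
  `∫ r_x⁴ ≤ 560⁴4⁴·2027025·D⁸(16H)⁸/β⁴` (`‖r_x‖_{L⁴} ≲ H²/β`), with integrability.

No definition; standard axioms.  HONEST LABEL: helper toward the OPEN registered stub F of one critic-PASSed line on the R2ξ″ RECORD-rung
crux 24003; no stub by name, no crux, rung or summit; the Yang–Mills mass gap is NOT proved by this file.
-/

set_option autoImplicit false

noncomputable section

open MeasureTheory ProbabilityTheory Finset
open scoped Matrix Matrix.Norms.Frobenius
open Literature.MathematicalPhysics.QuantumLattice
open Literature.MathematicalPhysics.QuantumFieldTheory
open Literature.MathematicalPhysics.QuantumFieldTheory.LatticeMaxwell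
open Summit.QuantumFields.YangMills.Theorems.WeakCouplingRates
open Summit.QuantumFields.YangMills.Theorems.ColdBoxAllGroups
open Summit.QuantumFields.YangMills.Theorems.FreeEnergyLogCoefficient

namespace Summit.QuantumFields.YangMills.Theorems.AllWindowsColdBoxBoxMidLine

/-! ## §1 Gaussian moments of one chart coordinate `a_e = extZero (unscaleTE t) e` -/

section Leg

variable {H D : ℕ}

/-- A value of the zero extension is either `0` or a value of the free-link data. -/
theorem extZero_eq_zero_or {V : Type*} [Zero V] (w : ColdFreeIdx H → V) (e : Literature.MathematicalPhysics.QuantumLattice.ZdEdge 4) :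
    extZero w e = 0 ∨ ∃ e' : ColdFreeIdx H, e'.1.1 = e ∧ extZero w e = w e' := by
  unfold extZero
  split_ifs with h1 h2
  · exact Or.inl rfl
  · exact Or.inr ⟨⟨⟨e, h1⟩, h2⟩, rfl, rfl⟩
  · exact Or.inl rfl

/-- **Even moments of one chart coordinate**: `∫ ‖a_e‖^{2k} dγ ≤ D^k·(2k−1)!!·(16H)^k/β^k` (`H ≥ 1`, `β > 0`, `k ≥ 1`), and the power is
integrable — for EVERY edge `e` of `ℤ⁴` (pinned edges give `0`). -/
theorem integral_norm_leg_pow_le (hH : 1 ≤ H) {β : ℝ} (hβ : 0 < β) (e : Literature.MathematicalPhysics.QuantumLattice.ZdEdge 4)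
    {k : ℕ} (hk : 1 ≤ k) :
    Integrable (fun t : TSpaceD H D => ‖extZero (unscaleTE H D β t) e‖ ^ (2 * k)) (gaussD H D) ∧
    ∫ t, ‖extZero (unscaleTE H D β t) e‖ ^ (2 * k) ∂(gaussD H D) ≤
      (D : ℝ) ^ k * (((2 * k - 1).doubleFactorial : ℕ) : ℝ) * (16 * (H : ℝ)) ^ k / β ^ k := by
  haveI : IsProbabilityMeasure (gaussD H D) := isProbabilityMeasure_gaussD H D
  have hRHS : 0 ≤ (D : ℝ) ^ k * (((2 * k - 1).doubleFactorial : ℕ) : ℝ) * (16 * (H : ℝ)) ^ k / β ^ k := by positivity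
  -- pinned or free, uniformly in `t`
  by_cases hfree : ∃ e' : ColdFreeIdx H, e'.1.1 = e
  · obtain ⟨e', rfl⟩ := hfree
    have heq : ∀ t : TSpaceD H D, extZero (unscaleTE H D β t) e'.1.1 = unscaleTE H D β t e' := fun t => extZero_apply_free _ _
    simp only [heq]
    obtain ⟨m, rfl⟩ : ∃ m, k = m + 1 := ⟨k - 1, by omega⟩
    -- `‖a_{e'}‖^{2(m+1)} = (Σ_a (t a σe')²)^{m+1} / β^{m+1} ≤ D^m Σ_a (t a σe')^{2(m+1)} / β^{m+1}`
    have hpt : ∀ t : TSpaceD H D, ‖unscaleTE H D β t e'‖ ^ (2 * (m + 1)) =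
        (∑ a : Fin D, WithLp.ofLp (t a) ((dirFreeEquiv H).symm e') ^ 2) ^ (m + 1) / β ^ (m + 1) := by
      intro t
      rw [pow_mul, norm_unscaleTE_sq hβ.le, div_pow]
    have hdom : ∀ t : TSpaceD H D, ‖unscaleTE H D β t e'‖ ^ (2 * (m + 1)) ≤
        (D : ℝ) ^ m * (∑ a : Fin D, WithLp.ofLp (t a) ((dirFreeEquiv H).symm e') ^ (2 * (m + 1))) / β ^ (m + 1) := by
      intro t
      rw [hpt t]
      exact div_le_div_of_nonneg_right (colourSum_sq_pow_le t _ m) (by positivity)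
    have hint : Integrable (fun t : TSpaceD H D =>
        (D : ℝ) ^ m * (∑ a : Fin D, WithLp.ofLp (t a) ((dirFreeEquiv H).symm e') ^ (2 * (m + 1))) / β ^ (m + 1)) (gaussD H D) := by
      refine Integrable.div_const (Integrable.const_mul (integrable_finsetSum _ fun a _ => ?_) _) _
      exact integrable_coord_pow_gaussD H D (a, (dirFreeEquiv H).symm e') (2 * (m + 1))
    have hmeas : AEStronglyMeasurable (fun t : TSpaceD H D => ‖unscaleTE H D β t e'‖ ^ (2 * (m + 1))) (gaussD H D) :=
      (measurable_norm_unscaleTE_pow β e' _).aestronglyMeasurable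
    have hI : Integrable (fun t : TSpaceD H D => ‖unscaleTE H D β t e'‖ ^ (2 * (m + 1))) (gaussD H D) :=
      Integrable.mono' hint hmeas (ae_of_all _ fun t => by
        rw [Real.norm_eq_abs, abs_of_nonneg (by positivity)]; exact hdom t)
    refine ⟨hI, ?_⟩
    calc ∫ t, ‖unscaleTE H D β t e'‖ ^ (2 * (m + 1)) ∂(gaussD H D)
        ≤ ∫ t, (D : ℝ) ^ m * (∑ a : Fin D, WithLp.ofLp (t a) ((dirFreeEquiv H).symm e') ^ (2 * (m + 1))) / β ^ (m + 1) ∂(gaussD H D) :=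
          integral_mono hI hint hdom
      _ = (D : ℝ) ^ m * (∑ a : Fin D, ∫ t, WithLp.ofLp (t a) ((dirFreeEquiv H).symm e') ^ (2 * (m + 1)) ∂(gaussD H D)) / β ^ (m + 1) := by
          rw [integral_div, integral_const_mul, integral_finsetSum _ fun a _ =>
            integrable_coord_pow_gaussD H D (a, (dirFreeEquiv H).symm e') (2 * (m + 1))]
      _ ≤ (D : ℝ) ^ m * (∑ _a : Fin D, (((2 * (m + 1) - 1).doubleFactorial : ℕ) : ℝ) * (16 * (H : ℝ)) ^ (m + 1)) / β ^ (m + 1) := by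
          gcongr with a _
          exact integral_coord_pow_even_gaussD_le hH D a _ (m + 1)
      _ = (D : ℝ) ^ (m + 1) * (((2 * (m + 1) - 1).doubleFactorial : ℕ) : ℝ) * (16 * (H : ℝ)) ^ (m + 1) / β ^ (m + 1) := by
          rw [Finset.sum_const, Finset.card_univ, Fintype.card_fin, nsmul_eq_mul]; ring
  · -- pinned edge: the coordinate vanishes identically
    have h0 : ∀ t : TSpaceD H D, extZero (unscaleTE H D β t) e = 0 := by
      intro t
      rcases extZero_eq_zero_or (unscaleTE H D β t) e with h | ⟨e', he', -⟩
      · exact h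
      · exact absurd ⟨e', he'⟩ hfree
    have hk0 : 2 * k ≠ 0 := by omega
    simp only [h0, norm_zero, zero_pow hk0, integral_zero]
    exact ⟨integrable_const _, hRHS⟩

end Leg
/-! ## §3 Moments of the local cubic term and of the quartic remainder of ONE plaquette -/

section LocalMoments

variable {H : ℕ}

/-- The linear circulation against its four legs: `‖circV a (x,i,j)‖ ≤ ‖a₁‖ + ‖a₂‖ + ‖a₃‖ + ‖a₄‖`. -/
theorem norm_circV_le_legs {D : ℕ} (a : Literature.MathematicalPhysics.QuantumLattice.ZdEdge 4 → EuclideanSpace ℝ (Fin D))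
    (x : Literature.Probability.LatticeModels.Site 4) (i j : Fin 4) :
    ‖circV a (x, i, j)‖ ≤ ‖a (x, i)‖ + ‖a (x + Pi.single i 1, j)‖ + ‖a (x + Pi.single j 1, i)‖ + ‖a (x, j)‖ := by
  unfold circV
  calc _ ≤ ‖a (x, i) + a (x + Pi.single i 1, j) - a (x + Pi.single j 1, i)‖ + ‖a (x, j)‖ := norm_sub_le _ _
    _ ≤ (‖a (x, i) + a (x + Pi.single i 1, j)‖ + ‖a (x + Pi.single j 1, i)‖) + ‖a (x, j)‖ := by gcongr; exact norm_sub_le _ _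
    _ ≤ ((‖a (x, i)‖ + ‖a (x + Pi.single i 1, j)‖) + ‖a (x + Pi.single j 1, i)‖) + ‖a (x, j)‖ := by gcongr; exact norm_add_le _ _

/-- **The local cubic term against its legs**: `|c_x(t)| ≤ 6β·(‖a₁‖+‖a₂‖+‖a₃‖+‖a₄‖)³` (`β ≥ 0`). -/
theorem abs_localCubic_le {N : ℕ} {G : Type*} [Group G] (ρ : G →* Matrix (Fin N) (Fin N) ℂ) {β : ℝ} (hβ : 0 ≤ β)
    (a : Literature.MathematicalPhysics.QuantumLattice.ZdEdge 4 → EuclideanSpace ℝ (Fin (dimE ρ)))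
    (x : Literature.Probability.LatticeModels.Site 4) (i j : Fin 4) :
    |β * ((chartCubic ρ (circV a (x, i, j)) (a (x, i)) (a (x + Pi.single i 1, j)) -
          chartCubic ρ (circV a (x, i, j)) (a (x, i)) (a (x + Pi.single j 1, i)) -
          chartCubic ρ (circV a (x, i, j)) (a (x, i)) (a (x, j)) -
          chartCubic ρ (circV a (x, i, j)) (a (x + Pi.single i 1, j)) (a (x + Pi.single j 1, i)) -
          chartCubic ρ (circV a (x, i, j)) (a (x + Pi.single i 1, j)) (a (x, j)) +
          chartCubic ρ (circV a (x, i, j)) (a (x + Pi.single j 1, i)) (a (x, j))) / 2)| ≤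
      6 * β * (‖a (x, i)‖ + ‖a (x + Pi.single i 1, j)‖ + ‖a (x + Pi.single j 1, i)‖ + ‖a (x, j)‖) ^ 3 := by
  have hs := norm_circV_le_legs a x i j
  have hb₁ : ‖a (x, i)‖ ≤ ‖a (x, i)‖ + ‖a (x + Pi.single i 1, j)‖ + ‖a (x + Pi.single j 1, i)‖ + ‖a (x, j)‖ := by
    linarith [norm_nonneg (a (x + Pi.single i 1, j)), norm_nonneg (a (x + Pi.single j 1, i)), norm_nonneg (a (x, j))]
  have hb₂ : ‖a (x + Pi.single i 1, j)‖ ≤ ‖a (x, i)‖ + ‖a (x + Pi.single i 1, j)‖ + ‖a (x + Pi.single j 1, i)‖ + ‖a (x, j)‖ := by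
    linarith [norm_nonneg (a (x, i)), norm_nonneg (a (x + Pi.single j 1, i)), norm_nonneg (a (x, j))]
  have hb₃ : ‖a (x + Pi.single j 1, i)‖ ≤ ‖a (x, i)‖ + ‖a (x + Pi.single i 1, j)‖ + ‖a (x + Pi.single j 1, i)‖ + ‖a (x, j)‖ := by
    linarith [norm_nonneg (a (x, i)), norm_nonneg (a (x + Pi.single i 1, j)), norm_nonneg (a (x, j))]
  have hb₄ : ‖a (x, j)‖ ≤ ‖a (x, i)‖ + ‖a (x + Pi.single i 1, j)‖ + ‖a (x + Pi.single j 1, i)‖ + ‖a (x, j)‖ := by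
    linarith [norm_nonneg (a (x, i)), norm_nonneg (a (x + Pi.single i 1, j)), norm_nonneg (a (x + Pi.single j 1, i))]
  have hsix := abs_six_terms_le (abs_chartCubic_le_cube ρ hs hb₁ hb₂) (abs_chartCubic_le_cube ρ hs hb₁ hb₃)
    (abs_chartCubic_le_cube ρ hs hb₁ hb₄) (abs_chartCubic_le_cube ρ hs hb₂ hb₃) (abs_chartCubic_le_cube ρ hs hb₂ hb₄)
    (abs_chartCubic_le_cube ρ hs hb₃ hb₄)
  rw [abs_mul, abs_div, abs_of_nonneg hβ, abs_two]
  calc β * (|_| / 2) ≤ β * (6 * (2 * (‖a (x, i)‖ + ‖a (x + Pi.single i 1, j)‖ + ‖a (x + Pi.single j 1, i)‖ + ‖a (x, j)‖) ^ 3) / 2) := by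
        gcongr
    _ = _ := by ring

/-- `(x₁+x₂+x₃+x₄)ⁿ⁺¹ ≤ 4ⁿ(x₁ⁿ⁺¹+x₂ⁿ⁺¹+x₃ⁿ⁺¹+x₄ⁿ⁺¹)` for `xᵢ ≥ 0`. -/
theorem add_four_pow_le {a b c d : ℝ} (ha : 0 ≤ a) (hb : 0 ≤ b) (hc : 0 ≤ c) (hd : 0 ≤ d) (n : ℕ) :
    (a + b + c + d) ^ (n + 1) ≤ 4 ^ n * (a ^ (n + 1) + b ^ (n + 1) + c ^ (n + 1) + d ^ (n + 1)) := by
  have h := pow_sum_le_card_mul_sum_pow (s := (Finset.univ : Finset (Fin 4))) (f := ![a, b, c, d])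
    (fun i _ => by fin_cases i <;> simp [ha, hb, hc, hd]) n
  simpa [Fin.sum_univ_four] using h

/-- **Fourth moment of a function dominated by the cubic leg bound.**  If `c` is a.e.-strongly measurable and
`|c t| ≤ 6β·(‖a₁‖+‖a₂‖+‖a₃‖+‖a₄‖)³` for the chart coordinates `a = extZero (unscaleTE H D β t)` of the legs of `(x,i,j)`, then `c⁴` is
`γ`-integrable and `∫ c⁴ dγ ≤ 6⁴·4¹²·10395·D⁶·(16H)⁶/β²` (`H ≥ 1`, `β > 0`): `‖c‖_{L⁴(γ)} ≲ H^{3/2}/√β`. -/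
theorem integral_pow_four_le_of_cubic_leg_bound {D : ℕ} (hH : 1 ≤ H) {β : ℝ} (hβ : 0 < β)
    (x : Literature.Probability.LatticeModels.Site 4) (i j : Fin 4) {c : TSpaceD H D → ℝ} (hcm : AEStronglyMeasurable c (gaussD H D))
    (hc : ∀ t, |c t| ≤ 6 * β * (‖extZero (unscaleTE H D β t) (x, i)‖ + ‖extZero (unscaleTE H D β t) (x + Pi.single i 1, j)‖ +
      ‖extZero (unscaleTE H D β t) (x + Pi.single j 1, i)‖ + ‖extZero (unscaleTE H D β t) (x, j)‖) ^ 3) :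
    Integrable (fun t => c t ^ 4) (gaussD H D) ∧
    ∫ t, c t ^ 4 ∂(gaussD H D) ≤ 6 ^ 4 * 4 ^ 12 * 10395 * (D : ℝ) ^ 6 * (16 * (H : ℝ)) ^ 6 / β ^ 2 := by
  -- the four leg moments of order 12
  obtain ⟨i₁, m₁⟩ := integral_norm_leg_pow_le (D := D) hH hβ (x, i) (k := 6) (by norm_num)
  obtain ⟨i₂, m₂⟩ := integral_norm_leg_pow_le (D := D) hH hβ (x + Pi.single i 1, j) (k := 6) (by norm_num)
  obtain ⟨i₃, m₃⟩ := integral_norm_leg_pow_le (D := D) hH hβ (x + Pi.single j 1, i) (k := 6) (by norm_num)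
  obtain ⟨i₄, m₄⟩ := integral_norm_leg_pow_le (D := D) hH hβ (x, j) (k := 6) (by norm_num)
  have hdf : (((2 * 6 - 1).doubleFactorial : ℕ) : ℝ) = 10395 := by norm_num [Nat.doubleFactorial]
  rw [hdf] at m₁ m₂ m₃ m₄
  -- pointwise domination `c⁴ ≤ 6⁴β⁴·4¹¹·Σ‖a_leg‖¹²`
  have hdom : ∀ t, c t ^ 4 ≤ (6 * β) ^ 4 * (4 ^ 11 * (‖extZero (unscaleTE H D β t) (x, i)‖ ^ (2 * 6) +
      ‖extZero (unscaleTE H D β t) (x + Pi.single i 1, j)‖ ^ (2 * 6) + ‖extZero (unscaleTE H D β t) (x + Pi.single j 1, i)‖ ^ (2 * 6) +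
      ‖extZero (unscaleTE H D β t) (x, j)‖ ^ (2 * 6))) := by
    intro t
    have h1 : c t ^ 4 = |c t| ^ 4 := by rw [pow_abs, abs_of_nonneg (by positivity)]
    have h2 : |c t| ^ 4 ≤ (6 * β * (‖extZero (unscaleTE H D β t) (x, i)‖ + ‖extZero (unscaleTE H D β t) (x + Pi.single i 1, j)‖ +
        ‖extZero (unscaleTE H D β t) (x + Pi.single j 1, i)‖ + ‖extZero (unscaleTE H D β t) (x, j)‖) ^ 3) ^ 4 :=
      pow_le_pow_left₀ (abs_nonneg _) (hc t) 4
    have h3 := add_four_pow_le (norm_nonneg (extZero (unscaleTE H D β t) (x, i)))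
      (norm_nonneg (extZero (unscaleTE H D β t) (x + Pi.single i 1, j))) (norm_nonneg (extZero (unscaleTE H D β t) (x + Pi.single j 1, i)))
      (norm_nonneg (extZero (unscaleTE H D β t) (x, j))) 11
    rw [h1]
    refine h2.trans ?_
    rw [mul_pow, ← pow_mul]
    exact mul_le_mul_of_nonneg_left h3 (by positivity)
  have hRint : Integrable (fun t => (6 * β) ^ 4 * (4 ^ 11 * (‖extZero (unscaleTE H D β t) (x, i)‖ ^ (2 * 6) +
      ‖extZero (unscaleTE H D β t) (x + Pi.single i 1, j)‖ ^ (2 * 6) + ‖extZero (unscaleTE H D β t) (x + Pi.single j 1, i)‖ ^ (2 * 6) +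
      ‖extZero (unscaleTE H D β t) (x, j)‖ ^ (2 * 6)))) (gaussD H D) := ((((i₁.add i₂).add i₃).add i₄).const_mul _).const_mul _
  have hI : Integrable (fun t => c t ^ 4) (gaussD H D) :=
    Integrable.mono' hRint (hcm.pow 4) (ae_of_all _ fun t => by
      rw [Real.norm_eq_abs, abs_of_nonneg (by positivity)]; exact hdom t)
  refine ⟨hI, ?_⟩
  have e123 := integral_add (i₁.add i₂) i₃
  have e1234 := integral_add ((i₁.add i₂).add i₃) i₄
  have e12 := integral_add i₁ i₂
  simp only [Pi.add_apply] at e123 e1234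
  calc ∫ t, c t ^ 4 ∂(gaussD H D) ≤ ∫ t, (6 * β) ^ 4 * (4 ^ 11 * (‖extZero (unscaleTE H D β t) (x, i)‖ ^ (2 * 6) +
        ‖extZero (unscaleTE H D β t) (x + Pi.single i 1, j)‖ ^ (2 * 6) + ‖extZero (unscaleTE H D β t) (x + Pi.single j 1, i)‖ ^ (2 * 6) +
        ‖extZero (unscaleTE H D β t) (x, j)‖ ^ (2 * 6))) ∂(gaussD H D) := integral_mono hI hRint hdom
    _ = (6 * β) ^ 4 * (4 ^ 11 * ((∫ t, ‖extZero (unscaleTE H D β t) (x, i)‖ ^ (2 * 6) ∂(gaussD H D)) +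
        (∫ t, ‖extZero (unscaleTE H D β t) (x + Pi.single i 1, j)‖ ^ (2 * 6) ∂(gaussD H D)) +
        (∫ t, ‖extZero (unscaleTE H D β t) (x + Pi.single j 1, i)‖ ^ (2 * 6) ∂(gaussD H D)) +
        (∫ t, ‖extZero (unscaleTE H D β t) (x, j)‖ ^ (2 * 6) ∂(gaussD H D)))) := by
        rw [integral_const_mul, integral_const_mul, e1234, e123, e12]
    _ ≤ (6 * β) ^ 4 * (4 ^ 11 * (4 * ((D : ℝ) ^ 6 * 10395 * (16 * (H : ℝ)) ^ 6 / β ^ 6))) := by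
        gcongr
        linarith
    _ = 6 ^ 4 * 4 ^ 12 * 10395 * (D : ℝ) ^ 6 * (16 * (H : ℝ)) ^ 6 / β ^ 2 := by field_simp

/-- **Second and fourth moments of the quartic remainder of one plaquette** `r = 560β(‖a₁‖⁴+‖a₂‖⁴+‖a₃‖⁴+‖a₄‖⁴)`:
`∫ r² dγ ≤ 560²·16·105·D⁴(16H)⁴/β²` and `∫ r⁴ dγ ≤ 560⁴·4⁴·2027025·D⁸(16H)⁸/β⁴` with integrability (`H ≥ 1`, `β > 0`). -/
theorem integral_remainder_moments_le {D : ℕ} (hH : 1 ≤ H) {β : ℝ} (hβ : 0 < β)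
    (x : Literature.Probability.LatticeModels.Site 4) (i j : Fin 4) :
    (Integrable (fun t : TSpaceD H D => (560 * β * (‖extZero (unscaleTE H D β t) (x, i)‖ ^ 4 +
        ‖extZero (unscaleTE H D β t) (x + Pi.single i 1, j)‖ ^ 4 + ‖extZero (unscaleTE H D β t) (x + Pi.single j 1, i)‖ ^ 4 +
        ‖extZero (unscaleTE H D β t) (x, j)‖ ^ 4)) ^ 2) (gaussD H D) ∧
      ∫ t, (560 * β * (‖extZero (unscaleTE H D β t) (x, i)‖ ^ 4 + ‖extZero (unscaleTE H D β t) (x + Pi.single i 1, j)‖ ^ 4 +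
        ‖extZero (unscaleTE H D β t) (x + Pi.single j 1, i)‖ ^ 4 + ‖extZero (unscaleTE H D β t) (x, j)‖ ^ 4)) ^ 2 ∂(gaussD H D) ≤
        560 ^ 2 * 16 * 105 * (D : ℝ) ^ 4 * (16 * (H : ℝ)) ^ 4 / β ^ 2) ∧
    (Integrable (fun t : TSpaceD H D => (560 * β * (‖extZero (unscaleTE H D β t) (x, i)‖ ^ 4 +
        ‖extZero (unscaleTE H D β t) (x + Pi.single i 1, j)‖ ^ 4 + ‖extZero (unscaleTE H D β t) (x + Pi.single j 1, i)‖ ^ 4 +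
        ‖extZero (unscaleTE H D β t) (x, j)‖ ^ 4)) ^ 4) (gaussD H D) ∧
      ∫ t, (560 * β * (‖extZero (unscaleTE H D β t) (x, i)‖ ^ 4 + ‖extZero (unscaleTE H D β t) (x + Pi.single i 1, j)‖ ^ 4 +
        ‖extZero (unscaleTE H D β t) (x + Pi.single j 1, i)‖ ^ 4 + ‖extZero (unscaleTE H D β t) (x, j)‖ ^ 4)) ^ 4 ∂(gaussD H D) ≤
        560 ^ 4 * 4 ^ 4 * 2027025 * (D : ℝ) ^ 8 * (16 * (H : ℝ)) ^ 8 / β ^ 4) := by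
  have hmeas : ∀ n : ℕ, AEStronglyMeasurable (fun t : TSpaceD H D => (560 * β * (‖extZero (unscaleTE H D β t) (x, i)‖ ^ 4 +
      ‖extZero (unscaleTE H D β t) (x + Pi.single i 1, j)‖ ^ 4 + ‖extZero (unscaleTE H D β t) (x + Pi.single j 1, i)‖ ^ 4 +
      ‖extZero (unscaleTE H D β t) (x, j)‖ ^ 4)) ^ n) (gaussD H D) := by
    intro n
    have hleg : ∀ e, Measurable fun t : TSpaceD H D => ‖extZero (unscaleTE H D β t) e‖ ^ 4 := fun e =>
      ((continuous_extZero_unscaleTE (H := H) D β e).norm.pow 4).measurable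
    exact ((((((hleg _).add (hleg _)).add (hleg _)).add (hleg _)).const_mul _).pow_const n).aestronglyMeasurable
  constructor
  · -- second moment: `r² ≤ 560²β²·4·Σ‖a‖⁸`
    obtain ⟨i₁, m₁⟩ := integral_norm_leg_pow_le (D := D) hH hβ (x, i) (k := 4) (by norm_num)
    obtain ⟨i₂, m₂⟩ := integral_norm_leg_pow_le (D := D) hH hβ (x + Pi.single i 1, j) (k := 4) (by norm_num)
    obtain ⟨i₃, m₃⟩ := integral_norm_leg_pow_le (D := D) hH hβ (x + Pi.single j 1, i) (k := 4) (by norm_num)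
    obtain ⟨i₄, m₄⟩ := integral_norm_leg_pow_le (D := D) hH hβ (x, j) (k := 4) (by norm_num)
    have hdf : (((2 * 4 - 1).doubleFactorial : ℕ) : ℝ) = 105 := by norm_num [Nat.doubleFactorial]
    rw [hdf] at m₁ m₂ m₃ m₄
    have hdom : ∀ t : TSpaceD H D, (560 * β * (‖extZero (unscaleTE H D β t) (x, i)‖ ^ 4 +
        ‖extZero (unscaleTE H D β t) (x + Pi.single i 1, j)‖ ^ 4 + ‖extZero (unscaleTE H D β t) (x + Pi.single j 1, i)‖ ^ 4 +
        ‖extZero (unscaleTE H D β t) (x, j)‖ ^ 4)) ^ 2 ≤ (560 * β) ^ 2 * (4 ^ 1 * (‖extZero (unscaleTE H D β t) (x, i)‖ ^ (2 * 4) +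
        ‖extZero (unscaleTE H D β t) (x + Pi.single i 1, j)‖ ^ (2 * 4) + ‖extZero (unscaleTE H D β t) (x + Pi.single j 1, i)‖ ^ (2 * 4) +
        ‖extZero (unscaleTE H D β t) (x, j)‖ ^ (2 * 4))) := by
      intro t
      rw [mul_pow]
      refine mul_le_mul_of_nonneg_left ?_ (by positivity)
      have h := add_four_pow_le (pow_nonneg (norm_nonneg (extZero (unscaleTE H D β t) (x, i))) 4)
        (pow_nonneg (norm_nonneg (extZero (unscaleTE H D β t) (x + Pi.single i 1, j))) 4)
        (pow_nonneg (norm_nonneg (extZero (unscaleTE H D β t) (x + Pi.single j 1, i))) 4)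
        (pow_nonneg (norm_nonneg (extZero (unscaleTE H D β t) (x, j))) 4) 1
      simp only [← pow_mul] at h
      exact h
    have hRint : Integrable (fun t : TSpaceD H D => (560 * β) ^ 2 * (4 ^ 1 * (‖extZero (unscaleTE H D β t) (x, i)‖ ^ (2 * 4) +
        ‖extZero (unscaleTE H D β t) (x + Pi.single i 1, j)‖ ^ (2 * 4) + ‖extZero (unscaleTE H D β t) (x + Pi.single j 1, i)‖ ^ (2 * 4) +
        ‖extZero (unscaleTE H D β t) (x, j)‖ ^ (2 * 4)))) (gaussD H D) :=
      ((((i₁.add i₂).add i₃).add i₄).const_mul (4 ^ 1 : ℝ)).const_mul ((560 * β) ^ 2)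
    have hI := Integrable.mono' hRint (hmeas 2) (ae_of_all _ fun t => by
      rw [Real.norm_eq_abs, abs_of_nonneg (by positivity)]; exact hdom t)
    refine ⟨hI, ?_⟩
    have e12 := integral_add i₁ i₂
    have e123 := integral_add (i₁.add i₂) i₃
    have e1234 := integral_add ((i₁.add i₂).add i₃) i₄
    simp only [Pi.add_apply] at e123 e1234
    calc _ ≤ _ := integral_mono hI hRint hdom
      _ = (560 * β) ^ 2 * (4 ^ 1 * ((∫ t, ‖extZero (unscaleTE H D β t) (x, i)‖ ^ (2 * 4) ∂(gaussD H D)) +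
          (∫ t, ‖extZero (unscaleTE H D β t) (x + Pi.single i 1, j)‖ ^ (2 * 4) ∂(gaussD H D)) +
          (∫ t, ‖extZero (unscaleTE H D β t) (x + Pi.single j 1, i)‖ ^ (2 * 4) ∂(gaussD H D)) +
          (∫ t, ‖extZero (unscaleTE H D β t) (x, j)‖ ^ (2 * 4) ∂(gaussD H D)))) := by
          rw [integral_const_mul, integral_const_mul, e1234, e123, e12]
      _ ≤ (560 * β) ^ 2 * (4 ^ 1 * (4 * ((D : ℝ) ^ 4 * 105 * (16 * (H : ℝ)) ^ 4 / β ^ 4))) := by gcongr; linarith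
      _ = _ := by field_simp; ring
  · -- fourth moment: `r⁴ ≤ 560⁴β⁴·4³·Σ‖a‖¹⁶`
    obtain ⟨i₁, m₁⟩ := integral_norm_leg_pow_le (D := D) hH hβ (x, i) (k := 8) (by norm_num)
    obtain ⟨i₂, m₂⟩ := integral_norm_leg_pow_le (D := D) hH hβ (x + Pi.single i 1, j) (k := 8) (by norm_num)
    obtain ⟨i₃, m₃⟩ := integral_norm_leg_pow_le (D := D) hH hβ (x + Pi.single j 1, i) (k := 8) (by norm_num)
    obtain ⟨i₄, m₄⟩ := integral_norm_leg_pow_le (D := D) hH hβ (x, j) (k := 8) (by norm_num)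
    have hdf : (((2 * 8 - 1).doubleFactorial : ℕ) : ℝ) = 2027025 := by norm_num [Nat.doubleFactorial]
    rw [hdf] at m₁ m₂ m₃ m₄
    have hdom : ∀ t : TSpaceD H D, (560 * β * (‖extZero (unscaleTE H D β t) (x, i)‖ ^ 4 +
        ‖extZero (unscaleTE H D β t) (x + Pi.single i 1, j)‖ ^ 4 + ‖extZero (unscaleTE H D β t) (x + Pi.single j 1, i)‖ ^ 4 +
        ‖extZero (unscaleTE H D β t) (x, j)‖ ^ 4)) ^ 4 ≤ (560 * β) ^ 4 * (4 ^ 3 * (‖extZero (unscaleTE H D β t) (x, i)‖ ^ (2 * 8) +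
        ‖extZero (unscaleTE H D β t) (x + Pi.single i 1, j)‖ ^ (2 * 8) + ‖extZero (unscaleTE H D β t) (x + Pi.single j 1, i)‖ ^ (2 * 8) +
        ‖extZero (unscaleTE H D β t) (x, j)‖ ^ (2 * 8))) := by
      intro t
      rw [mul_pow]
      refine mul_le_mul_of_nonneg_left ?_ (by positivity)
      have h := add_four_pow_le (pow_nonneg (norm_nonneg (extZero (unscaleTE H D β t) (x, i))) 4)
        (pow_nonneg (norm_nonneg (extZero (unscaleTE H D β t) (x + Pi.single i 1, j))) 4)
        (pow_nonneg (norm_nonneg (extZero (unscaleTE H D β t) (x + Pi.single j 1, i))) 4)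
        (pow_nonneg (norm_nonneg (extZero (unscaleTE H D β t) (x, j))) 4) 3
      simp only [← pow_mul] at h
      exact h
    have hRint : Integrable (fun t : TSpaceD H D => (560 * β) ^ 4 * (4 ^ 3 * (‖extZero (unscaleTE H D β t) (x, i)‖ ^ (2 * 8) +
        ‖extZero (unscaleTE H D β t) (x + Pi.single i 1, j)‖ ^ (2 * 8) + ‖extZero (unscaleTE H D β t) (x + Pi.single j 1, i)‖ ^ (2 * 8) +
        ‖extZero (unscaleTE H D β t) (x, j)‖ ^ (2 * 8)))) (gaussD H D) :=
      ((((i₁.add i₂).add i₃).add i₄).const_mul (4 ^ 3 : ℝ)).const_mul ((560 * β) ^ 4)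
    have hI := Integrable.mono' hRint (hmeas 4) (ae_of_all _ fun t => by
      rw [Real.norm_eq_abs, abs_of_nonneg (by positivity)]; exact hdom t)
    refine ⟨hI, ?_⟩
    have e12 := integral_add i₁ i₂
    have e123 := integral_add (i₁.add i₂) i₃
    have e1234 := integral_add ((i₁.add i₂).add i₃) i₄
    simp only [Pi.add_apply] at e123 e1234
    calc _ ≤ _ := integral_mono hI hRint hdom
      _ = (560 * β) ^ 4 * (4 ^ 3 * ((∫ t, ‖extZero (unscaleTE H D β t) (x, i)‖ ^ (2 * 8) ∂(gaussD H D)) +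
          (∫ t, ‖extZero (unscaleTE H D β t) (x + Pi.single i 1, j)‖ ^ (2 * 8) ∂(gaussD H D)) +
          (∫ t, ‖extZero (unscaleTE H D β t) (x + Pi.single j 1, i)‖ ^ (2 * 8) ∂(gaussD H D)) +
          (∫ t, ‖extZero (unscaleTE H D β t) (x, j)‖ ^ (2 * 8) ∂(gaussD H D)))) := by
          rw [integral_const_mul, integral_const_mul, e1234, e123, e12]
      _ ≤ (560 * β) ^ 4 * (4 ^ 3 * (4 * ((D : ℝ) ^ 8 * 2027025 * (16 * (H : ℝ)) ^ 8 / β ^ 8))) := by gcongr; linarith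
      _ = _ := by field_simp

end LocalMoments


end Summit.QuantumFields.YangMills.Theorems.AllWindowsColdBoxBoxMidLine

end
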